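import Summits.QuantumFields.YangMills.Theorems.FluctuationComparisonRegPrIntLS2BetaArcLetterOfGuard
import HarnessLib

/-!
# S2β · THE SUP CHAIN ∕ (D-stage): THE DECAYED ARC PROFILE AT THE STATION PREFIX — every internal gauged level `i` of the two stage towers has arcs
# `≤ s₀·q(L)^(K−J−i) + D₁(L, C_B)·α` for ANY guard threshold `s₀ ≤ 1∕128` (GENERIC — «guard as a window constant», G1′): the datum guard decays geometrically
# from the top and the window feeds only `α` (sup window only — ‴ and ⁗ alike)

Cell `ym3-torus` (rung R3 = continuum `SU(2)` Yang–Mills on T³ at fixed lattice data — NOT d = 4, NOT infinite volume, NOT a mass gap, NOT Clay).  Width seat «width 12»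
`ym3-torus-px12` (gen 26), FREE px helper on crux `stmt-QuantumFields-20520`; `--supports` helper, count-neutral, DEFINITION-FREE (0 `def`∕`instance`∕`notation`∕`sorry`,
default heartbeats).

WHY (architect px17 g22 22:10:33Z HAZARD «FB-σ» on FILE P: the ρ̃ letter's mixed columns `2·(4·sU + aU)·mA`, `2·(4·sA + aA)·mA` multiply the feedback `mA` by the
σ-CLASS bond sizes `sU, sA` of the gauged stage field and of its hat lift; the only kernel arc bound at the station was ✓p835602's flat `≤ ¼`, far too large for a
`β_X`-share; «a second, sharper arc letter `σ_t ≤ σ_top + C·α` feeds the commutator columns — px12»).  THIS FILE is that letter, in the stronger DECAYED form.  Road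
(one tower, §1): ✓`…ArcLetterOfGuard` §1's pointwise bootstrap gives `s_t ≤ M(L)` at every gauged level; the guarded quadratic step then LINEARISES,
`s_t ≤ q·s_{t+1} + ρ_t` with `q := r₀ + C₂·M < 1`, and the source is α-SMALL at every level: `ρ_t = A₁·θg(t) + A₂·θg(t+1) ≤ α·Z₂` with the window inside and the
top threshold `(C_B + 1)·α` (STRICTLY above the (BKG) value `C_B·α` because `α > 0`), `Z₂ := A₁∕G + A₂∕G + A₂·(C_B+1)`; iterating DOWN from the START
`s_{K−J} ≤ s₀` (the datum guard itself, ANY `s₀ ≤ 1∕128` — architect 22:21:56Z RULING «FB-σ» (iii′): the threshold is a CLASS constant the feedback budget may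
lower, so it is GENERIC here; ✓`norm_logVec_iter_le_of_mem_fibre`): `s_t ≤ s₀·q^(K−J−t) + D₁·α`, `D₁ := Z₂∕(1−q)`.  §2 = the two gauged towers at
the STATION PREFIX VERBATIM (LEAD knit v3 l.81–132, == ✓`arcLetter_of_guard`'s), memberships exactly as there; `α > 0` is READ OFF the prefix (`U₀ ∈ histGood θ` at the
finest level gives `θ K > 0`, the window at `i = K` gives `((5L)²∕4)·θ K ≤ α`).  Only the SUP window is used, so the letter serves the ‴ and the (E5) ⁗ prefixes alike.

WHAT IS PROVED (sorry-free).  ★★`exists_alpha_arcDecay_window` (one tower: `∃ α₀(L,C_B) > 0, ∃ q(L) ∈ [0,1), ∃ D₁(L,C_B) ≥ 0`; sup window + `0 < α` + top (BKG) + datum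
guard `s₀ ≤ 1∕128` ⟹ `arc ≤ s₀·q^(K−J−t) + D₁·α` at every gauged level `t ≤ K−J`), ★★★`arcDecay_of_guard G s₀ hs₀ hGs` (two towers at the station prefix, internal
levels `1 ≤ i < K−J`, guard class `G F J V → arc(V e) ≤ s₀`).  CONSTANTS (closed form, for the (α) assembler's `β_X` print): `r₀ = L⁻¹`, `NP = (d−1)((L−1)∕2)(L+1)`, `G = (5L)²∕4`, `A₁ = (π∕2)(NP + 2G)`,
`A₂ = (π∕2)·NP·L⁻²·(π∕2)`, `C₂ = (π∕2)·NP·24·L⁻²`, `M = min(¼, (1−r₀)∕(2(C₂+1)))`, `q = r₀ + C₂M ≤ (1+r₀)∕2`, `Z₂ = A₁∕G + A₂∕G + A₂(C_B+1)`, `D₁ = Z₂∕(1−q)`,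
`α₀ = (1−r₀)M∕(2(Z₂+1))`.

HONEST SCOPE.  Elementary bootstrap∕recursion + re-plumbing of landed letters; window, (BKG), (E4), memberships, the 17 `AxStage` clauses are HYPOTHESES; nothing of
Bałaban's renormalisation-group analysis is asserted or proved ([Balaban1985RegularSpaces] Lemma 1 (1.24)–(1.26) p.79, (1.29) p.81 — the printed small-field regularity
this profile imitates; [Balaban1985Averaging] Prop. 4 (128)–(135) pp.37–38).  FILE P's other columns, the (α) assembler, the knit, GAP♯∘ (`stub_uniformFibreGapOrbit`,
registry 3732b7df UNTOUCHED), the five registered stubs (0∕5), S2β, 20520, 19936, 19200, `YM3TorusSU2` are NOT proved; no registered stub is closed; rung R3 — NOT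
d = 4, NOT infinite volume, NOT a mass gap, NOT Clay; the Yang–Mills mass gap is NOT proved.
-/

set_option autoImplicit false

noncomputable section

namespace Summit.QuantumFields.YangMills.Theorems.FluctuationComparisonRegPrIntLS2BetaArcDecayOfGuard

open Finset
open scoped Real
open Literature.MathematicalPhysics.QuantumLattice (su2Quat)
open Literature.MathematicalPhysics.QuantumFieldTheory.Balaban1983to89
open T4Continuum T3ContinuumYM3Torus T3UnitScaleTilt T3TiltDescent T3LevelShift BlockAveraging
open T4CubeChartGnomonic (SU2)
open T4HaarSU2ExpChart (expPoint)
open T4ExpWindowSmallField (logVec)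
open T3UnitLawDensityEML (ℰp)
open T3ConstrainedMinimiser (fibre)
open ExpMeanLog (deltaSU)
open B10Eq27TorusAxialLog (rel axialT)
open Summit.QuantumFields.YangMills.Theorems.FluctuationComparisonRegPrIntLS2BetaRelativeTowerSupProfileStart (exists_supProfile_relativeTower_start)
open Summit.QuantumFields.YangMills.Theorems.FluctuationComparisonRegPrIntLS2BetaRelativeTowerSupBudgetStart (norm_logVec_iter_le_of_mem_fibre)
open Summit.QuantumFields.YangMills.Theorems.FluctuationComparisonRegPrIntLS2BetaRelativeTowerSupBudget128 (one_div_128_le_ceiling)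
open Summit.QuantumFields.YangMills.Theorems.FluctuationComparisonRegPrIntLS2BetaResidualGauge
  (gaugeAct_mul_eq gaugeAct_mem_fibre_iff_of_residual gaugeAct_mem_histGood_iff)
open Summit.QuantumFields.YangMills.Theorems.FluctuationComparisonRegPrIntLS2BetaHFlatOfRelativeLetter (residual_of_iter_eq)
open Summit.QuantumFields.YangMills.Theorems.FluctuationComparisonRegPrIntLS2BetaPeanoSmooth (iter_eq_of_descendTo_eq)
open Summit.QuantumFields.YangMills.Theorems.FluctuationComparisonRegPrIntLS2BetaArcLetterOfGuard (sup_bootstrap_start_pointwise)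

/-! ## §1 One tower: the decayed arc profile from the α-window, `0 < α`, the top (BKG) clause and the datum's guard -/

/-- ★★ **THE DECAYED ARC PROFILE OF A STAGE TOWER IN THE GUARD `1∕128`, SUP-WINDOW EDITION**: `∃ α₀(L,C_B) > 0, ∃ q(L) ∈ [0,1), ∃ D₁(L,C_B) ≥ 0` such that under the
sup window on `J < i ≤ K`, `0 < α ≤ 1∕24`, `α < δ_SU`, `α ≤ α₀`, a datum guard `s₀ ≤ 1∕128` (GENERIC), `U ∈ fibre ∩ histGood(θ)` with top plaquettes `≤ C_B·α`
and the gauged stage tower's clauses, EVERY gauged level `t ≤ K − J` has arcs `≤ s₀·q^(K−J−t) + D₁·α`. [cite: Balaban1985RegularSpaces, Lemma 1 (1.24)-(1.26) p.79, (1.29) p.81] -/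
theorem exists_alpha_arcDecay_window (L : ℕ) (hL : 1 < L) (C_B : ℝ) (hCB : 0 ≤ C_B) :
    ∃ α₀ : ℝ, 0 < α₀ ∧ ∃ q : ℝ, 0 ≤ q ∧ q < 1 ∧ ∃ D₁ : ℝ, 0 ≤ D₁ ∧ ∀ (F : T3Family) (θ : ℕ → ℝ), F.L = L → (∀ i, 0 ≤ θ i) →
      ∀ (J K : ℕ) (hJK : J ≤ K) (α : ℝ), (∀ i, J < i → i ≤ K → (((5 * F.L : ℕ) : ℝ) ^ 2 / 4) * θ i ≤ α) →
      0 < α → α ≤ 1 / 24 → α < deltaSU (Fin 2) → α ≤ α₀ → ∀ (s₀ : ℝ), s₀ ≤ 1 / 128 →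
      ∀ (Vd : GaugeField (F.P J) 0 SU2), (∀ e, ‖logVec (su2Quat (Vd e))‖ ≤ s₀) →
      ∀ (U : GaugeField (F.P K) 0 SU2), U ∈ fibre F ℰp J K hJK Vd → U ∈ histGood F ℰp θ K J →
      (∀ p : Plaq (F.P K) (K - J),
        dist1 (GaugeField.plaqHol (Averaging.iter (fun k => blockAvg (P := F.P K) (j := k) ℰp) (K - J) U) p) ≤ C_B * α) →
      ∀ (g : (j : ℕ) → Site (F.P K) j → SU2) (w : (t : ℕ) → PBond (F.P K) t → PBond (F.P K) (t + 1) → ℝ)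
        (V : (t : ℕ) → GaugeField (F.P K) t SU2),
        (∀ t, t < K - J → ∀ b e, w t b e = if e.dir = b.dir ∧ (b.src b.dir - emb e.src b.dir).val < (F.P K).L then
          ∏ ν ∈ Finset.univ.erase b.dir, max 0 (1 - ((rel (emb e.src) b.src ν).natAbs : ℝ) / (F.P K).L) else 0) →
        (∀ t, t < K - J → ∀ b, V t b = expPoint (∑ e, w t b e • ((((F.P K).L : ℕ) : ℝ)⁻¹ •
          logVec (su2Quat (GaugeField.gaugeAct (g (t + 1)) (Averaging.iter (fun k => blockAvg (P := F.P K) (j := k) ℰp) (t + 1) U) e))))) →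
        (∀ j, K - J ≤ j → ∀ y, g j y = 1) →
        (∀ t, t < K - J → ∀ z : Site (F.P K) t,
          axialT (GaugeField.gaugeAct (g t) (Averaging.iter (fun k => blockAvg (P := F.P K) (j := k) ℰp) t U)) (emb (blockOf z)) z =
            axialT (V t) (emb (blockOf z)) z) →
        (∀ t, t < K - J → avgFun ℰp (GaugeField.gaugeAct (g t) (Averaging.iter (fun k => blockAvg (P := F.P K) (j := k) ℰp) t U)) =
          GaugeField.gaugeAct (g (t + 1)) (Averaging.iter (fun k => blockAvg (P := F.P K) (j := k) ℰp) (t + 1) U)) →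
        ∀ t, t ≤ K - J → ∀ b,
          ‖logVec (su2Quat (GaugeField.gaugeAct (g t) (Averaging.iter (fun k => blockAvg (P := F.P K) (j := k) ℰp) t U) b))‖ ≤
            s₀ * q ^ (K - J - t) + D₁ * α := by
  have hL' : (1 : ℝ) < L := by exact_mod_cast hL
  obtain ⟨NP, hNP, hNP0⟩ : ∃ x : ℝ, x = (((3 - 1) * ((L - 1) / 2) * (L + 1) : ℕ) : ℝ) ∧ 0 ≤ x := ⟨_, rfl, by positivity⟩
  obtain ⟨G, hG, hG0⟩ : ∃ x : ℝ, x = ((((3 + 2) * L : ℕ) : ℝ) ^ 2 / 4) ∧ 0 < x := ⟨_, rfl, by positivity⟩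
  obtain ⟨A₁, hA₁, hA₁0⟩ : ∃ x : ℝ, x = π / 2 * (NP + 2 * G) ∧ 0 ≤ x := ⟨_, rfl, by positivity⟩
  obtain ⟨A₂, hA₂, hA₂0⟩ : ∃ x : ℝ, x = π / 2 * (NP * ((L : ℝ)⁻¹) ^ 2 * (π / 2)) ∧ 0 ≤ x := ⟨_, rfl, by positivity⟩
  obtain ⟨C₂, hC₂, hC₂0⟩ : ∃ x : ℝ, x = π / 2 * NP * 24 * ((L : ℝ)⁻¹) ^ 2 ∧ 0 ≤ x := ⟨_, rfl, by positivity⟩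
  obtain ⟨r₀, hr₀, hr00⟩ : ∃ x : ℝ, x = (L : ℝ)⁻¹ ∧ 0 ≤ x := ⟨_, rfl, by positivity⟩
  have hr01 : r₀ < 1 := by rw [hr₀]; exact inv_lt_one_of_one_lt₀ hL'
  have h1r : 0 < 1 - r₀ := by linarith
  obtain ⟨M, hM, hM0⟩ : ∃ x : ℝ, x = min (1 / 4) ((1 - r₀) / (2 * (C₂ + 1))) ∧ 0 < x := ⟨_, rfl, lt_min (by norm_num) (by positivity)⟩
  have hM4 : M ≤ 1 / 4 := by rw [hM]; exact min_le_left _ _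
  have hMC : C₂ * M ≤ (1 - r₀) / 2 := by
    have h1 : M ≤ (1 - r₀) / (2 * (C₂ + 1)) := by rw [hM]; exact min_le_right _ _
    calc C₂ * M ≤ (C₂ + 1) * ((1 - r₀) / (2 * (C₂ + 1))) := by nlinarith
      _ = (1 - r₀) / 2 := by field_simp
  obtain ⟨Smax, hSmax, hSmax0⟩ : ∃ x : ℝ, x = (1 - r₀) / 2 * M ∧ 0 < x := ⟨_, rfl, by positivity⟩
  obtain ⟨Z₂, hZ₂, hZ₂0⟩ : ∃ x : ℝ, x = A₁ / G + A₂ / G + A₂ * (C_B + 1) ∧ 0 ≤ x := ⟨_, rfl, by positivity⟩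
  obtain ⟨α₀, hα₀, hα₀0⟩ : ∃ x : ℝ, x = Smax / (Z₂ + 1) ∧ 0 < x := ⟨_, rfl, by positivity⟩
  obtain ⟨q, hq, hq0⟩ : ∃ x : ℝ, x = r₀ + C₂ * M ∧ 0 ≤ x := ⟨_, rfl, by positivity⟩
  have hq1 : q < 1 := by rw [hq]; linarith
  have h1q : 0 < 1 - q := by linarith
  obtain ⟨D₁, hD₁, hD₁0⟩ : ∃ x : ℝ, x = Z₂ / (1 - q) ∧ 0 ≤ x := ⟨_, rfl, by positivity⟩
  have hD₁Z : q * D₁ + Z₂ = D₁ := by rw [hD₁]; field_simp; ring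
  have hZα₀ : α₀ * Z₂ ≤ Smax := by
    rw [hα₀]
    calc Smax / (Z₂ + 1) * Z₂ ≤ Smax / (Z₂ + 1) * (Z₂ + 1) := mul_le_mul_of_nonneg_left (by linarith) (by positivity)
      _ = Smax := div_mul_cancel₀ _ (by positivity)
  have hsmall₁ : Smax ≤ (1 - r₀) / 2 * M := by rw [hSmax]
  have h128 : (1 : ℝ) / 128 ≤ M := by rw [hM, hC₂, hr₀, hNP]; exact one_div_128_le_ceiling L hL
  refine ⟨α₀, hα₀0, q, hq0, hq1, D₁, hD₁0, fun F θ hFL hθ0 J K hJK α hwin hαpos h24 hδ hαα s₀ hs₀' Vd hVσ' U hUf hUg htop g w V hw hV hT1 hax hT5 => ?_⟩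
  have hPd : (F.P K).d = 3 := rfl
  have hPL : (F.P K).L = L := hFL
  have hm : K - J ≤ (F.P K).m + (F.P K).K := by show K - J ≤ F.m + K; omega
  have hGF : (((5 * F.L : ℕ) : ℝ) ^ 2 / 4) = G := by rw [hG, hFL]
  have hCα : C_B * α < (C_B + 1) * α := by
    have : (C_B + 1) * α = C_B * α + α := by ring
    linarith only [this, hαpos]
  -- thresholds on the gauged levels: the window inside, `(C_B + 1)·α` (STRICTLY above the (BKG) value) at the datum level
  obtain ⟨θg, hθg⟩ : ∃ f : ℕ → ℝ, f = fun t => if t < K - J then θ (K - t) else (C_B + 1) * α := ⟨_, rfl⟩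
  have hθg0 : ∀ t, 0 ≤ θg t := by
    intro t
    by_cases ht : t < K - J
    · rw [hθg]; simp only [ht, if_true]; exact hθ0 _
    · rw [hθg]; simp only [ht, if_false]; exact mul_nonneg (by linarith only [hCB]) hαpos.le
  have hθU : ∀ t, t ≤ K - J → PlaqSmall (θg t) (GaugeField.gaugeAct (g t) (Averaging.iter (fun k => blockAvg (P := F.P K) (j := k) ℰp) t U)) := by
    intro t ht p
    rw [T4ReTrLipUnitary.plaqHol_gaugeAct, GaugeGroup.dist1_conj]
    rcases Nat.lt_or_ge t (K - J) with h | h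
    · rw [hθg]; simp only [h, if_true]; exact hUg t (by omega) p
    · obtain rfl : t = K - J := le_antisymm ht h
      rw [hθg]; simp only [lt_irrefl, if_false]
      exact lt_of_le_of_lt (htop p) hCα
  have hwinθ : ∀ t, t < K - J → G * θ (K - t) ≤ α := by
    intro t ht
    rw [← hGF]
    exact hwin (K - t) (by omega) (by omega)
  have hg1 : ∀ t, t < K - J → (((((F.P K).d + 2) * (F.P K).L : ℕ) : ℝ) ^ 2 / 4) * θg t < ExpMeanLog.deltaSU (Fin 2) := by
    intro t ht; rw [hPd, hPL, ← hG, hθg]; simp only [ht, if_true]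
    exact (hwinθ t ht).trans_lt hδ
  have hg2 : ∀ t, t < K - J → (((((F.P K).d + 2) * (F.P K).L : ℕ) : ℝ) ^ 2 / 4) * θg t ≤ 1 / 6 := by
    intro t ht; rw [hPd, hPL, ← hG, hθg]; simp only [ht, if_true]
    exact (hwinθ t ht).trans (h24.trans (by norm_num))
  obtain ⟨s, hsm, hs0, hsb, hstep⟩ := exists_supProfile_relativeTower_start hm
    (fun t => GaugeField.gaugeAct (g t) (Averaging.iter (fun k => blockAvg (P := F.P K) (j := k) ℰp) t U)) w V hw hV hax hT5 θg hθg0 hθU hg1 hg2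
  -- the START: the datum guard itself
  have hstart0 : s (K - J) ≤ s₀ := by
    refine hsm s₀ fun b => ?_
    have hg0 : g (K - J) = fun _ => 1 := funext (hT1 (K - J) le_rfl)
    simp only [hg0, T4AxialGaugeFixing.gaugeAct_const_one]
    exact norm_logVec_iter_le_of_mem_fibre F hJK hUf hVσ' b
  have hstart : s (K - J) ≤ M := hstart0.trans (hs₀'.trans h128)
  obtain ⟨ρ, hρ⟩ : ∃ f : ℕ → ℝ, f = fun t => A₁ * θg t + A₂ * θg (t + 1) := ⟨_, rfl⟩
  have hstep' : ∀ t, t < K - J → s (t + 1) ≤ 1 / 4 → s t ≤ r₀ * s (t + 1) + ρ t + C₂ * s (t + 1) ^ 2 := by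
    intro t ht h4
    have h := hstep t ht h4
    rw [hPd, hPL] at h
    refine h.trans (le_of_eq ?_)
    simp only [hρ, hA₁, hA₂, hC₂, hr₀, hNP, hG]
    ring
  -- the source is α-SMALL at every level: `ρ t ≤ α·Z₂` (`t < K − J`)
  have hρZ : ∀ t, t < K - J → ρ t ≤ α * Z₂ := by
    intro t ht
    have hαG : 0 ≤ α / G := div_nonneg hαpos.le hG0.le
    have h1 : θg t ≤ α / G := by
      rw [hθg]; simp only [ht, if_true]
      rw [le_div_iff₀ hG0, mul_comm]; exact hwinθ t ht
    have h2 : θg (t + 1) ≤ α / G + (C_B + 1) * α := by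
      have hC1 : 0 ≤ (C_B + 1) * α := mul_nonneg (by linarith only [hCB]) hαpos.le
      by_cases h : t + 1 < K - J
      · rw [hθg]; simp only [h, if_true]
        have h3 : θ (K - (t + 1)) ≤ α / G := by rw [le_div_iff₀ hG0, mul_comm]; exact hwinθ (t + 1) h
        linarith only [h3, hC1]
      · rw [hθg]; simp only [h, if_false]
        linarith only [hαG]
    calc ρ t = A₁ * θg t + A₂ * θg (t + 1) := by rw [hρ]
      _ ≤ A₁ * (α / G) + A₂ * (α / G + (C_B + 1) * α) := add_le_add (mul_le_mul_of_nonneg_left h1 hA₁0) (mul_le_mul_of_nonneg_left h2 hA₂0)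
      _ = α * Z₂ := by rw [hZ₂]; ring
  have hρS : ∀ t, t < K - J → ρ t ≤ Smax := by
    intro t ht
    have h4 : α * Z₂ ≤ α₀ * Z₂ := mul_le_mul_of_nonneg_right hαα hZ₂0
    linarith only [hρZ t ht, h4, hZα₀]
  -- every level `≤ M`, the linearised step, and the downward recursion from the top
  have hall := sup_bootstrap_start_pointwise s ρ (K - J) r₀ C₂ (1 / 4) M Smax hstart hs0 hρS hstep' hr00 hC₂0 hM4 hsmall₁ hMC
  have hlin : ∀ t, t < K - J → s t ≤ q * s (t + 1) + α * Z₂ := by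
    intro t ht
    have hS : s (t + 1) ≤ M := hall (t + 1) (by omega)
    have h2 : C₂ * s (t + 1) ^ 2 ≤ C₂ * M * s (t + 1) := by
      rw [mul_assoc, sq]; exact mul_le_mul_of_nonneg_left (mul_le_mul_of_nonneg_right hS (hs0 (t + 1))) hC₂0
    calc s t ≤ r₀ * s (t + 1) + ρ t + C₂ * s (t + 1) ^ 2 := hstep' t ht (hS.trans hM4)
      _ ≤ r₀ * s (t + 1) + α * Z₂ + C₂ * M * s (t + 1) := by linarith only [h2, hρZ t ht]
      _ = q * s (t + 1) + α * Z₂ := by rw [hq]; ring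
  have hdec : ∀ n, ∀ t, t + n = K - J → s t ≤ s₀ * q ^ n + D₁ * α := by
    intro n
    induction n with
    | zero =>
      intro t ht
      have htm : t = K - J := by omega
      rw [htm, pow_zero, mul_one]
      linarith only [hstart0, mul_nonneg hD₁0 hαpos.le]
    | succ n ih =>
      intro t ht
      have hS := ih (t + 1) (by omega)
      have hqS := mul_le_mul_of_nonneg_left hS hq0
      calc s t ≤ q * s (t + 1) + α * Z₂ := hlin t (by omega)
        _ ≤ q * (s₀ * q ^ n + D₁ * α) + α * Z₂ := by linarith only [hqS]
        _ = s₀ * q ^ (n + 1) + (q * D₁ + Z₂) * α := by ring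
        _ = s₀ * q ^ (n + 1) + D₁ * α := by rw [hD₁Z]
  intro t ht b
  exact (hsb t ht b).trans (hdec (K - J - t) t (by omega))

/-! ## §2 Two towers at the station prefix: the decayed arc profile of both gauged towers -/

/-- ★★★ **THE DECAYED ARC PROFILE AT THE STATION PREFIX, FROM THE GUARD**: for every datum class `G` with a small-bond conjunct of ANY threshold `s₀ ≤ 1∕128`,
`∃ α₀(L,C_B) > 0, ∃ q(L) ∈ [0,1), ∃ D₁(L,C_B) ≥ 0` (all `s₀`-free) and — under the station prefix of LEAD's knit VERBATIM — every internal gauged level `1 ≤ i < K − J`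
of BOTH stage towers has arcs `≤ s₀·q^(K−J−i) + D₁·α` (§1 on each tower; `0 < α` read off `U₀ ∈ histGood θ` at the finest level and the window at `i = K`; memberships as in
✓`arcLetter_of_guard`). [cite: Balaban1985RegularSpaces, Lemma 1 (1.24)-(1.26) p.79, (1.29) p.81; Balaban1985Averaging, Prop. 4 (128)-(135) pp.37-38] -/
theorem arcDecay_of_guard
    (G : (F : T3Family) → (J : ℕ) → GaugeField (F.P J) 0 (Matrix.specialUnitaryGroup (Fin 2) ℂ) → Prop) (s₀ : ℝ) (hs₀ : s₀ ≤ 1 / 128)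
    (hGs : ∀ (F : T3Family) (J : ℕ) (V : GaugeField (F.P J) 0 (Matrix.specialUnitaryGroup (Fin 2) ℂ)),
      G F J V → ∀ e, ‖logVec (su2Quat (V e))‖ ≤ s₀) :
      ∀ (L : ℕ), 1 < L → ∀ (C_B : ℝ), 0 ≤ C_B → ∃ α₀ : ℝ, 0 < α₀ ∧ ∃ q : ℝ, 0 ≤ q ∧ q < 1 ∧ ∃ D₁ : ℝ, 0 ≤ D₁ ∧ ∀ (F : T3Family), F.L = L →
      ∀ (J K : ℕ) (hJK : J ≤ K) (θ : ℕ → ℝ), (∀ i, 0 ≤ θ i) → ∀ (α : ℝ), (∀ i, J < i → i ≤ K → (((5 * F.L : ℕ) : ℝ) ^ 2 / 4) * θ i ≤ α) →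
        α ≤ 1 / 24 → α < deltaSU (Fin 2) → 157 * α < ((F.L : ℝ) ^ 2)⁻¹ → α ≤ α₀ →
        ∀ U₀ : GaugeField (F.P K) 0 (Matrix.specialUnitaryGroup (Fin 2) ℂ), U₀ ∈ histGood F ℰp θ K J →
        G F J (descendTo F ℰp J K hJK U₀) →
        (∀ t, t ≤ K - J → ∀ p : Plaq (F.P K) t,
          dist1 (GaugeField.plaqHol (Averaging.iter (fun k => BlockAveraging.blockAvg (P := F.P K) (j := k) ℰp) t U₀) p) ≤
            C_B * α * (F.L : ℝ) ^ (2 * t) * ((F.L : ℝ)⁻¹) ^ (2 * (K - J))) →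
        ∀ ζ : PBond (F.P K) 0 → EuclideanSpace ℝ (Fin 3), (∀ ℓ, ‖ζ ℓ‖ ≤ Real.pi) →
          (fun ℓ => expPoint (ζ ℓ) * U₀ ℓ : GaugeField (F.P K) 0 (Matrix.specialUnitaryGroup (Fin 2) ℂ)) ∈ histGood F ℰp θ K J →
            descendTo F ℰp J K hJK (fun ℓ => expPoint (ζ ℓ) * U₀ ℓ : GaugeField (F.P K) 0 (Matrix.specialUnitaryGroup (Fin 2) ℂ)) = descendTo F ℰp J K hJK U₀ →
            ∀ (wt : (j : ℕ) → PBond (F.P K) j → PBond (F.P K) (j + 1) → ℝ)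
            (lift : (j : ℕ) → GaugeField (F.P K) (j + 1) SU2 → GaugeField (F.P K) j SU2)
            (U₁ : GaugeField (F.P K) 0 SU2) (g g₀ : (j : ℕ) → Site (F.P K) j → SU2),
          (∀ j b e, wt j b e = if e.dir = b.dir ∧ (b.src b.dir - emb e.src b.dir).val < (F.P K).L then
              ∏ ν ∈ Finset.univ.erase b.dir, max 0 (1 - ((rel (emb e.src) b.src ν).natAbs : ℝ) / (F.P K).L) else 0) →
          (∀ j X b, lift j X b = expPoint (∑ e, wt j b e • ((((F.P K).L : ℕ) : ℝ)⁻¹ • logVec (su2Quat (X e))))) →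
          (∀ j, j < K - J → ∀ x, g j x =
            (axialT (lift j (GaugeField.gaugeAct (g (j + 1)) (Averaging.iter (fun k => blockAvg (P := F.P K) (j := k) ℰp) (j + 1) (fun ℓ => expPoint (ζ ℓ) * U₀ ℓ))))
                (emb (blockOf x)) x)⁻¹ *
              g (j + 1) (blockOf x) * axialT (Averaging.iter (fun k => blockAvg (P := F.P K) (j := k) ℰp) j (fun ℓ => expPoint (ζ ℓ) * U₀ ℓ)) (emb (blockOf x)) x) →
          (∀ j, K - J ≤ j → ∀ y, g j y = 1) →
          (∀ j, j < K - J → ∀ y : Site (F.P K) (j + 1), g j (emb y) = g (j + 1) y) →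
          (∀ X : GaugeField (F.P K) 0 SU2, ∀ j, j ≤ K - J →
            Averaging.iter (fun k => blockAvg (P := F.P K) (j := k) ℰp) j (GaugeField.gaugeAct (g 0) X) =
              GaugeField.gaugeAct (g j) (Averaging.iter (fun k => blockAvg (P := F.P K) (j := k) ℰp) j X)) →
          (∀ j, j < K - J → ∀ x,
            axialT (GaugeField.gaugeAct (g j) (Averaging.iter (fun k => blockAvg (P := F.P K) (j := k) ℰp) j (fun ℓ => expPoint (ζ ℓ) * U₀ ℓ))) (emb (blockOf x)) x =
              axialT (lift j (GaugeField.gaugeAct (g (j + 1)) (Averaging.iter (fun k => blockAvg (P := F.P K) (j := k) ℰp) (j + 1) (fun ℓ => expPoint (ζ ℓ) * U₀ ℓ))))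
                (emb (blockOf x)) x) →
          (∀ j, j < K - J →
            (blockAvg (P := F.P K) (j := j) ℰp).avg (GaugeField.gaugeAct (g j) (Averaging.iter (fun k => blockAvg (P := F.P K) (j := k) ℰp) j (fun ℓ => expPoint (ζ ℓ) * U₀ ℓ))) =
              GaugeField.gaugeAct (g (j + 1)) (Averaging.iter (fun k => blockAvg (P := F.P K) (j := k) ℰp) (j + 1) (fun ℓ => expPoint (ζ ℓ) * U₀ ℓ))) →
          (∀ j, j < K - J → ∀ x, g₀ j x =
            (axialT (lift j (GaugeField.gaugeAct (g₀ (j + 1)) (Averaging.iter (fun k => blockAvg (P := F.P K) (j := k) ℰp) (j + 1) U₁)))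
                (emb (blockOf x)) x)⁻¹ *
              g₀ (j + 1) (blockOf x) * axialT (Averaging.iter (fun k => blockAvg (P := F.P K) (j := k) ℰp) j U₁) (emb (blockOf x)) x) →
          (∀ j, K - J ≤ j → ∀ y, g₀ j y = 1) →
          (∀ j, j < K - J → ∀ y : Site (F.P K) (j + 1), g₀ j (emb y) = g₀ (j + 1) y) →
          (∀ X : GaugeField (F.P K) 0 SU2, ∀ j, j ≤ K - J →
            Averaging.iter (fun k => blockAvg (P := F.P K) (j := k) ℰp) j (GaugeField.gaugeAct (g₀ 0) X) =
              GaugeField.gaugeAct (g₀ j) (Averaging.iter (fun k => blockAvg (P := F.P K) (j := k) ℰp) j X)) →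
          (∀ j, j < K - J → ∀ x,
            axialT (GaugeField.gaugeAct (g₀ j) (Averaging.iter (fun k => blockAvg (P := F.P K) (j := k) ℰp) j U₁)) (emb (blockOf x)) x =
              axialT (lift j (GaugeField.gaugeAct (g₀ (j + 1)) (Averaging.iter (fun k => blockAvg (P := F.P K) (j := k) ℰp) (j + 1) U₁)))
                (emb (blockOf x)) x) →
          (∀ j, j < K - J →
            (blockAvg (P := F.P K) (j := j) ℰp).avg (GaugeField.gaugeAct (g₀ j) (Averaging.iter (fun k => blockAvg (P := F.P K) (j := k) ℰp) j U₁)) =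
              GaugeField.gaugeAct (g₀ (j + 1)) (Averaging.iter (fun k => blockAvg (P := F.P K) (j := k) ℰp) (j + 1) U₁)) →
          (∀ X : GaugeField (F.P K) 0 SU2, Averaging.iter (fun k => blockAvg (P := F.P K) (j := k) ℰp) (K - J) (GaugeField.gaugeAct (fun x => (g 0 x)⁻¹) X) = Averaging.iter (fun k => blockAvg (P := F.P K) (j := k) ℰp) (K - J) X) →
          (∀ X : GaugeField (F.P K) 0 SU2, Averaging.iter (fun k => blockAvg (P := F.P K) (j := k) ℰp) (K - J) (GaugeField.gaugeAct (g₀ 0) X) = Averaging.iter (fun k => blockAvg (P := F.P K) (j := k) ℰp) (K - J) X) →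
          U₀ = GaugeField.gaugeAct (fun x => (g 0 x)⁻¹ * g₀ 0 x) U₁ →

                      ∀ i, 1 ≤ i → i < K - J → ∀ e : PBond (F.P K) i,
            ‖logVec (su2Quat (GaugeField.gaugeAct (g i) (Averaging.iter (fun k => blockAvg (P := F.P K) (j := k) ℰp) i (fun ℓ => expPoint (ζ ℓ) * U₀ ℓ)) e))‖ ≤
                s₀ * q ^ (K - J - i) + D₁ * α ∧
            ‖logVec (su2Quat (GaugeField.gaugeAct (g₀ i) (Averaging.iter (fun k => blockAvg (P := F.P K) (j := k) ℰp) i U₁) e))‖ ≤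
                s₀ * q ^ (K - J - i) + D₁ * α := by
  intro L hL C_B hCB
  obtain ⟨α₀, hα₀, q, hq0, hq1, D₁, hD₁, H⟩ := exists_alpha_arcDecay_window L hL C_B hCB
  refine ⟨α₀, hα₀, q, hq0, hq1, D₁, hD₁, ?_⟩
  intro F hFL J K hJK θ hθ0 α hwin h24 hδ _h157 hαα U₀ hU₀g hG hBKG ζ _hζ hWg hfib wt lift U₁ g g₀ hwt hlift _hg hgtop _hgemb _hT3 hT4 havg
    _hg₀ hg₀top _hg₀emb _hT3' hT4' havg₀ hres hres₀ hU₀ i hi1 hiK e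
  -- `0 < α`: the finest-level plaquettes of `U₀` are `< θ K` (histGood), and the window at `i = K` reads `((5L)²∕4)·θ K ≤ α`
  have hPd : (F.P K).d = 3 := rfl
  have hαpos : 0 < α := by
    have hd1 : 1 < (F.P K).d := by rw [hPd]; norm_num
    have p₀ : Plaq (F.P K) 0 := ⟨default, ⟨0, by omega⟩, ⟨1, hd1⟩, by show (0 : ℕ) < 1; norm_num⟩
    have h1 := hU₀g 0 (by omega) p₀
    have h3 : 0 < θ (K - 0) := lt_of_le_of_lt (GaugeGroup.dist1_nonneg _) h1
    rw [Nat.sub_zero] at h3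
    have h2 := hwin K (by omega) le_rfl
    have hG5 : (0 : ℝ) < ((5 * F.L : ℕ) : ℝ) ^ 2 / 4 := by
      have : (0 : ℝ) < ((5 * F.L : ℕ) : ℝ) := by rw [hFL]; exact_mod_cast (show 0 < 5 * L by omega)
      positivity
    exact lt_of_lt_of_le (mul_pos hG5 h3) h2
  have hV : ∀ e', ‖logVec (su2Quat (descendTo F ℰp J K hJK U₀ e'))‖ ≤ s₀ := hGs F J _ hG
  have hFL0 : (0 : ℝ) < (F.L : ℝ) := by rw [hFL]; exact_mod_cast (lt_trans Nat.zero_lt_one hL)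
  have hLL : (F.L : ℝ) ^ (2 * (K - J)) * ((F.L : ℝ)⁻¹) ^ (2 * (K - J)) = 1 := by
    rw [← mul_pow, mul_inv_cancel₀ hFL0.ne', one_pow]
  have htop₀ : ∀ p : Plaq (F.P K) (K - J),
      dist1 (GaugeField.plaqHol (Averaging.iter (fun k => blockAvg (P := F.P K) (j := k) ℰp) (K - J) U₀) p) ≤ C_B * α := by
    intro p
    have h := hBKG (K - J) le_rfl p
    rw [mul_assoc (C_B * α), hLL, mul_one] at h
    exact h
  -- the partner `W := exp(ζ)·U₀`: in the datum's fibre by (E4) (`hfib` itself), same top field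
  have hWtop : ∀ p : Plaq (F.P K) (K - J),
      dist1 (GaugeField.plaqHol (Averaging.iter (fun k => blockAvg (P := F.P K) (j := k) ℰp) (K - J)
        (fun ℓ => expPoint (ζ ℓ) * U₀ ℓ : GaugeField (F.P K) 0 (Matrix.specialUnitaryGroup (Fin 2) ℂ))) p) ≤ C_B * α := by
    intro p
    rw [iter_eq_of_descendTo_eq F hJK hfib]
    exact htop₀ p
  have hwres : ∀ X : GaugeField (F.P K) 0 SU2,
      descendTo F ℰp J K hJK (GaugeField.gaugeAct (fun x => (g 0 x)⁻¹ * g₀ 0 x) X) = descendTo F ℰp J K hJK X := by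
    refine residual_of_iter_eq F hJK _ fun X => ?_
    have e1 : GaugeField.gaugeAct (fun x => (g 0 x)⁻¹ * g₀ 0 x) X =
        GaugeField.gaugeAct (fun x => (g 0 x)⁻¹) (GaugeField.gaugeAct (g₀ 0) X) := gaugeAct_mul_eq (fun x => (g 0 x)⁻¹) (g₀ 0) X
    rw [e1, hres, hres₀]
  have hU₁f : U₁ ∈ fibre F ℰp J K hJK (descendTo F ℰp J K hJK U₀) := by
    rw [← gaugeAct_mem_fibre_iff_of_residual F hJK hwres U₁, ← hU₀]; exact rfl
  have hU₁g : U₁ ∈ histGood F ℰp θ K J := by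
    rw [← gaugeAct_mem_histGood_iff F (fun x => (g 0 x)⁻¹ * g₀ 0 x) θ J U₁, ← hU₀]; exact hU₀g
  have hU₁top : ∀ p : Plaq (F.P K) (K - J),
      dist1 (GaugeField.plaqHol (Averaging.iter (fun k => blockAvg (P := F.P K) (j := k) ℰp) (K - J) U₁) p) ≤ C_B * α := by
    intro p
    have e1 : Averaging.iter (fun k => blockAvg (P := F.P K) (j := k) ℰp) (K - J) U₁ =
        Averaging.iter (fun k => blockAvg (P := F.P K) (j := k) ℰp) (K - J) U₀ := by
      have e2 : GaugeField.gaugeAct (fun x => (g 0 x)⁻¹ * g₀ 0 x) U₁ =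
          GaugeField.gaugeAct (fun x => (g 0 x)⁻¹) (GaugeField.gaugeAct (g₀ 0) U₁) := gaugeAct_mul_eq (fun x => (g 0 x)⁻¹) (g₀ 0) U₁
      rw [hU₀, e2, hres, hres₀]
    rw [e1]
    exact htop₀ p
  constructor
  · exact H F θ hFL hθ0 J K hJK α hwin hαpos h24 hδ hαα s₀ hs₀ (descendTo F ℰp J K hJK U₀) hV _ hfib hWg hWtop g wt
      (fun t => lift t (GaugeField.gaugeAct (g (t + 1)) (Averaging.iter (fun k => blockAvg (P := F.P K) (j := k) ℰp) (t + 1)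
        (fun ℓ => expPoint (ζ ℓ) * U₀ ℓ : GaugeField (F.P K) 0 (Matrix.specialUnitaryGroup (Fin 2) ℂ)))))
      (fun t _ b e' => hwt t b e') (fun t _ b => hlift t _ b) hgtop (fun t ht z => hT4 t ht z) (fun t ht => havg t ht) i hiK.le e
  · exact H F θ hFL hθ0 J K hJK α hwin hαpos h24 hδ hαα s₀ hs₀ (descendTo F ℰp J K hJK U₀) hV U₁ hU₁f hU₁g hU₁top g₀ wt
      (fun t => lift t (GaugeField.gaugeAct (g₀ (t + 1)) (Averaging.iter (fun k => blockAvg (P := F.P K) (j := k) ℰp) (t + 1) U₁)))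
      (fun t _ b e' => hwt t b e') (fun t _ b => hlift t _ b) hg₀top (fun t ht z => hT4' t ht z) (fun t ht => havg₀ t ht) i hiK.le e

end Summit.QuantumFields.YangMills.Theorems.FluctuationComparisonRegPrIntLS2BetaArcDecayOfGuard

end
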